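import Summits.QuantumFields.YangMills.Theorems.LuscherReductionTwistedTraceScalingBOStiffFlatBridge
import Summits.QuantumFields.YangMills.Theorems.LuscherReductionTwistedTraceScalingRecordAnalytic
import Summits.QuantumFields.YangMills.Theorems.LuscherReductionTwistedTraceScalingInnerTwoZone
import Summits.QuantumFields.YangMills.Theorems.LuscherReductionTwistedTraceScalingValleyLinkProx
import Summits.QuantumFields.YangMills.Theorems.LuscherReductionTwistedTraceScalingValleyBOWeak
import Summits.QuantumFields.YangMills.Theorems.LuscherReductionTwistedTraceScalingOnionRefinedScales
import HarnessLib

/-!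
# C4-CORE(s) IS IN THE TREE for `1/6 < s < 1/5`; COARSE-UPPER(L) ⟸ ONE remaining statement — the SHELL ∕ VALLEY GAIN at the core radius `β^{−s}`
# (lane A of S-BASE, crux `TwistedTraceScaling` stmt-QuantumFields-20203, line «twolattice», stub `stub_fixedLatticeTraceLaw`; lead g23;
# design note `pub/ym-fleet/ym-luscher-20007-p1/COARSE-DESIGN.md` §22, `HANDOFF-g23.md`)

The (B-ST) pen is closed (✓`…BOStiffFlatBridge.recordAnalyticInput`, g22): for `L ≥ 2` and `1/6 < s < 1/4` the analytic input RECORD of C4-CORE is inhabited,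
`∃ M₀ ≥ 2, ∀ M ≥ M₀, Nonempty (RecordAnalyticInput L s M)`.  Composed with ✓`…RecordAnalytic.innerNoIntruderOneOrbitAt_of_analyticInput` (`0 < s < 1/5`) this file books
* ★★★ `innerNoIntruderOneOrbitAt_record (hL : 2 ≤ L) (hs6 : 1/6 < s) (hs5 : s < 1/5) : InnerNoIntruderOneOrbitAt L (powScale s)` — **C4-CORE(s), the one-orbit INNER
  NO-INTRUDER at the core radius `β^{−s}`, UNCONDITIONAL** at every fixed lattice size `L ≥ 2`, every `s ∈ (1/6, 1/5)`;
and hence the state of COARSE-UPPER(L) (`L ≥ 2`) — the no-intruder bound `λ_k ≤ e^{−dΛ/L}·λ₀` for every `d < Δ_k` deep in the femto window — modulo ONE named statement,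
in each of the four typed currencies of the tree (any `s ∈ (1/6, 1/5)`):
* ★★★ `coarseUpper_of_shellSmall` ⟸ the small-action SHELL GAIN `InnerShellGainSmallAt L (powScale s) (powScale (1/40)) (powScale (17/20))` (two-zone door
  ✓`coarseNoIntruderAt_of_core_shellSmall_fortieth`);
* ★★★ `coarseUpper_of_valleyGain` ⟸ the VALLEY GAIN `ValleyGainAt L (powScale s) (powScale q)`, any `q < 8/9` (onion ✓`coarseNoIntruderAt_of_valley_oneOrbit_pow₉`);
* ★★★ `coarseUpper_of_valleyBO` ⟸ the BO sub-target `ValleyBOAt L (powScale s) (powScale q)`, any `4s < q < 8/9` (✓`coarseNoIntruderAt_of_bo_pow`, GEOM ✓`valleyGeomAt_pow`);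
* ★★★ `coarseUpper_of_valleyBOWeak` ⟸ its honest-currency twin `ValleyBOWeakAt L (powScale s) (powScale q)`, any `4s < q < 8/9` (✓`coarseNoIntruderAt_of_boWeak_pow`).
Also `nonempty_nzSite_of_two_le` (`2 ≤ L → Nonempty (NzSite L)`), discharging the `Nonempty (NzSite L)` hypothesis of the record.
HONEST FRAMING: bookkeeping compositions at FIXED lattice size `L ≥ 2`, eventually in `β`; the SHELL ∕ VALLEY gain at radius `β^{−s}`, `s ∈ (1/6, 1/5)`, is OPEN
(RED's floor chain caps at `s < 2/51`, ✓`…Negative.R22.red_floor_chain_cap`); COARSE-LOWER(L) and COARSE-TAIL(L) are separate thirds of S-BASE; `stub_cmpTwoLoop`,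
`stub_labelTracking` and the crux `TwistedTraceScaling` stay OPEN; CONDITIONAL route R2b1 (Lüscher two-lattice reduction); not infinite volume, not a mass gap, not Clay.
No named facts, no `sorry`.
-/

set_option autoImplicit false

noncomputable section

open MeasureTheory Filter Topology Real
open scoped BigOperators
open Literature.MathematicalPhysics.QuantumFieldTheory
open Literature.MathematicalPhysics.QuantumLattice

namespace Summit.QuantumFields.YangMills.Theorems.FemtoTransferGap.TwoLattice.ConstTube

open Summit.QuantumFields.YangMills.Theorems.FemtoTransferGap

variable {L : ℕ} [NeZero L]

/-! ## §1 C4-CORE(s) from the record -/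

omit [NeZero L] in
/-- A lattice of size `L ≥ 2` has a non-zero site (the constant site `1`). [folklore] -/
theorem nonempty_nzSite_of_two_le (hL : 2 ≤ L) : Nonempty (NzSite L) := by
  haveI : Fact (1 < L) := ⟨hL⟩
  exact ⟨⟨fun _ => 1, fun h => one_ne_zero (congrFun h 0)⟩⟩

/-- ★★★ **C4-CORE(s) — the one-orbit INNER NO-INTRUDER at the core radius `β^{−s}`, UNCONDITIONAL** for `L ≥ 2` and `1/6 < s < 1/5`: for every `k`, `ε > 0`,
eventually in `β`, every nondegenerate `(k+1)`-family of bounded measurable gauge-invariant functions supported in `{orbitDist < β^{−s}}` contains `ψ ≠ 0` with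
`⟨ψ,K_βψ⟩·μ₀ ≤ e^{ελ_b(L³β)}·μ_k·λ₀·‖ψ‖²`.  Composition of ✓`recordAnalyticInput` (the (B-ST) pen, `1/6 < s < 1/4`) with ✓`innerNoIntruderOneOrbitAt_of_analyticInput` (`s < 1/5`)
at a common fat factor `M = max M₀ M₀'`. [cite: Luscher1983, §3] [cite: SjostrandZworski2007, §2] -/
theorem innerNoIntruderOneOrbitAt_record (hL : 2 ≤ L) {s : ℝ} (hs6 : 1 / 6 < s) (hs5 : s < 1 / 5) :
    InnerNoIntruderOneOrbitAt L (powScale s) := by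
  have hLz : Nonempty (NzSite L) := nonempty_nzSite_of_two_le hL
  obtain ⟨M₀, -, hrec⟩ := recordAnalyticInput (L := L) hLz hL hs6 (by linarith)
  obtain ⟨M₁, -, hcore⟩ := innerNoIntruderOneOrbitAt_of_analyticInput (L := L) hLz (by linarith) hs5
  obtain ⟨A⟩ := hrec (max M₀ M₁) (le_max_left _ _)
  exact hcore (max M₀ M₁) (le_max_right _ _) A

/-! ## §2 COARSE-UPPER(L) modulo ONE statement, in four currencies -/

/-- ★★★ **COARSE-UPPER(L) ⟸ the small-action SHELL GAIN at the core radius** (`L ≥ 2`, `1/6 < s < 1/5`): `InnerShellGainSmallAt L (β^{−s}) (β^{−1/40}) (β^{−17/20})`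
gives the no-intruder bound `λ_k(L,β) ≤ e^{−d·Λ/L}·λ₀(L,β)` for every `k`, every `d < Δ_k`, deep in the femto window (two-zone door + C4-CORE(s) of §1).
[cite: Luscher1983, §3] [cite: LuscherMunster1984, §2] -/
theorem coarseUpper_of_shellSmall (hL : 2 ≤ L) {s : ℝ} (hs6 : 1 / 6 < s) (hs5 : s < 1 / 5)
    (hShell : InnerShellGainSmallAt L (powScale s) (powScale (1 / 40)) (powScale (17 / 20))) :
    ∀ k : ℕ, ∀ d : ℝ, d < levelGap k → ∃ lam0 : ℝ, 0 < lam0 ∧ ∀ lam : ℝ, 0 < lam → lam ≤ lam0 →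
      ∀ β : ℝ, InFemtoWindow lam β L →
        levelValue su2Rep L β k ≤ Real.exp (-(d * luscherLambda β L) / L) * levelValue su2Rep L β 0 :=
  coarseNoIntruderAt_of_core_shellSmall_fortieth hL (by linarith) (by linarith) (innerNoIntruderOneOrbitAt_record hL hs6 hs5) hShell

/-- ★★★ **COARSE-UPPER(L) ⟸ the VALLEY GAIN at the core radius** (`L ≥ 2`, `1/6 < s < 1/5`, any action exponent `q < 8/9`): `ValleyGainAt L (β^{−s}) (β^{−q})` gives
the no-intruder bound (refined onion at nine regions + C4-CORE(s)). [cite: Luscher1983, §3] [cite: LuscherMunster1984, §2] -/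
theorem coarseUpper_of_valleyGain (hL : 2 ≤ L) {s q : ℝ} (hs6 : 1 / 6 < s) (hs5 : s < 1 / 5) (hq : q < 8 / 9)
    (hV : ValleyGainAt L (powScale s) (powScale q)) :
    ∀ k : ℕ, ∀ d : ℝ, d < levelGap k → ∃ lam0 : ℝ, 0 < lam0 ∧ ∀ lam : ℝ, 0 < lam → lam ≤ lam0 →
      ∀ β : ℝ, InFemtoWindow lam β L →
        levelValue su2Rep L β k ≤ Real.exp (-(d * luscherLambda β L) / L) * levelValue su2Rep L β 0 :=
  coarseNoIntruderAt_of_valley_oneOrbit_pow₉ (by linarith) (by linarith) hq hV (innerNoIntruderOneOrbitAt_record hL hs6 hs5)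

/-- ★★★ **COARSE-UPPER(L) ⟸ the BO sub-target of the valley at the core radius** (`L ≥ 2`, `1/6 < s < 1/5`, `4s < q < 8/9`): `ValleyBOAt L (β^{−s}) (β^{−q})` gives the
no-intruder bound (C3 skeleton with the proved geometry ✓`valleyGeomAt_pow` + C4-CORE(s)). [cite: Luscher1983, §3] [cite: LuscherMunster1984, §2] -/
theorem coarseUpper_of_valleyBO (hL : 2 ≤ L) {s q : ℝ} (hs6 : 1 / 6 < s) (hs5 : s < 1 / 5) (hsq : 4 * s < q) (hq : q < 8 / 9)
    (hBO : ValleyBOAt L (powScale s) (powScale q)) :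
    ∀ k : ℕ, ∀ d : ℝ, d < levelGap k → ∃ lam0 : ℝ, 0 < lam0 ∧ ∀ lam : ℝ, 0 < lam → lam ≤ lam0 →
      ∀ β : ℝ, InFemtoWindow lam β L →
        levelValue su2Rep L β k ≤ Real.exp (-(d * luscherLambda β L) / L) * levelValue su2Rep L β 0 :=
  coarseNoIntruderAt_of_bo_pow (by linarith) (by linarith) hsq hq hBO (innerNoIntruderOneOrbitAt_record hL hs6 hs5)

/-- ★★★ **COARSE-UPPER(L) ⟸ the BO sub-target in honest currency** (`L ≥ 2`, `1/6 < s < 1/5`, `4s < q < 8/9`): `ValleyBOWeakAt L (β^{−s}) (β^{−q})` (slack `e^{±εβ^{−s}}`)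
gives the no-intruder bound. [cite: Luscher1983, §3] [cite: LuscherMunster1984, §2] -/
theorem coarseUpper_of_valleyBOWeak (hL : 2 ≤ L) {s q : ℝ} (hs6 : 1 / 6 < s) (hs5 : s < 1 / 5) (hsq : 4 * s < q) (hq : q < 8 / 9)
    (hBO : ValleyBOWeakAt L (powScale s) (powScale q)) :
    ∀ k : ℕ, ∀ d : ℝ, d < levelGap k → ∃ lam0 : ℝ, 0 < lam0 ∧ ∀ lam : ℝ, 0 < lam → lam ≤ lam0 →
      ∀ β : ℝ, InFemtoWindow lam β L →
        levelValue su2Rep L β k ≤ Real.exp (-(d * luscherLambda β L) / L) * levelValue su2Rep L β 0 :=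
  coarseNoIntruderAt_of_boWeak_pow (by linarith) (by linarith) hsq hq hBO (innerNoIntruderOneOrbitAt_record hL hs6 hs5)

end Summit.QuantumFields.YangMills.Theorems.FemtoTransferGap.TwoLattice.ConstTube

end
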